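import Literature.AlgebraicGeometry.Resolution.InseparableLocalUniformizationHeightStepFinal
import Literature.AlgebraicGeometry.Resolution.InseparableLocalUniformizationAbhyankarProofs
import Literature.AlgebraicGeometry.Resolution.AbhyankarToroidalChartsInertial
import Literature.AlgebraicGeometry.Resolution.AbhyankarResidueSeparability
import Literature.AlgebraicGeometry.Resolution.ToricChartNormal
import HarnessLib

/-!
# Inseparable local uniformization, §4.2: the trust base of `Temkin2013HeightStep`

Topic: `Literature/AlgebraicGeometry/Resolution`. M. Temkin, *Inseparable local uniformization*,
J. Algebra 373 (2013) 65–119 = arXiv:0804.1554v3, §4.2 "Induction on height" (pp. 50–51;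
pp. 30–31 of the 41-pp. arXiv version held in the literature store), vendored as the named fact
`Temkin2013HeightStep` (`InseparableLocalUniformization.lean`: the corrected relative Thm. 1.3.2
for all valuation rings of height `≤ n`, `n ≥ 1`, implies it for height `≤ n + 1`).

This leaf file only ASSEMBLES theorems of the tree, to record on what the discharge
`Temkin2013HeightStep_holds` still rests. By `InseparableLocalUniformizationHeightStepFinal.lean`
(`Temkin2013HeightStep.of_abhyankar_smoothFibre_lemma332nft`) the fact follows from
`{Temkin2013Abhyankar, Temkin2013RelativeCurveSmoothFibre, Temkin2013_Lemma332_nft}`; and the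
Abhyankar base Thm. 5.5.2 (i) is itself assembled in the tree from §5
(`Temkin2013Abhyankar.of_section5`, `InseparableLocalUniformizationAbhyankarProofs.lean`) out of
Thm. 5.5.3 (`Temkin2013_Thm553.of_stability`, `AbhyankarResidueSeparability.lean`) and
Thm. 5.5.1 (iii) (`Temkin2013_Thm551iii.of_inertial`, `ToricChartNormal.lean`, with
`Temkin2013_Thm551iii_inertial.of_stability`, `AbhyankarToroidalChartsInertial.lean`), both of
which rest on ONE external theorem, the generalized stability theorem of F.-V. Kuhlmann
(`Kuhlmann2010Stability`, `ValuationDefect.lean`; Temkin 2013, Remark 2.1.3). Hence: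

* `Temkin2013Abhyankar.of_stability : Kuhlmann2010Stability → Temkin2013Abhyankar` — Thm. 5.5.2
  (i) (`n = 1`, non-logarithmic) from the generalized stability theorem alone;
* `Temkin2013HeightStep.of_stability_smoothFibre_lemma332nft :
    Kuhlmann2010Stability → Temkin2013RelativeCurveSmoothFibre → Temkin2013_Lemma332_nft →
    Temkin2013HeightStep` — the induction step on the height from exactly three named facts,
  each a published theorem with its own number: Kuhlmann 2010, Thm. 1.1 (generalized
  stability); Temkin 2013, Thm. 3.3.1 in the smooth-generic-fibre case (Berkovich-analytic:
  Thm. 3.2.6, stable modification); Temkin 2013, Lemma 3.3.2 (decompletion), corrected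
  rendering. Every other printed ingredient of §§3.3, 4.1, 4.2, 5.4, 5.5 used on the way is a
  theorem of the tree.

So `Temkin2013HeightStep_holds` is the term
`Temkin2013HeightStep.of_stability_smoothFibre_lemma332nft Kuhlmann2010Stability_holds
Temkin2013RelativeCurveSmoothFibre_holds Temkin2013_Lemma332_nft_holds` as soon as those three
discharges exist.

## Sources

* M. Temkin, *Inseparable local uniformization*, arXiv:0804.1554v3: §4.2 (pp. 50–51), proof of
  Thm. 4.1.1 (pp. 47–50), Thm. 3.3.1 and Lemma 3.3.2 (pp. 44–46), Thm. 5.5.1 (iii), Thm. 5.5.2,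
  Thm. 5.5.3 (pp. 59–61), Remark 2.1.3 (p. 10).
* F.-V. Kuhlmann, *Elimination of ramification I: The generalized stability theorem*, Trans.
  AMS 362 (2010), Thm. 1.1.
-/

noncomputable section

namespace Literature.AlgebraicGeometry.Resolution

universe u

/-- **Temkin 2013, Thm. 5.5.2 (i) (`n = 1`, non-logarithmic) from the generalized stability
theorem alone**: Thm. 5.5.3 and Thm. 5.5.1 (iii) both follow from `Kuhlmann2010Stability` in the
tree (`Temkin2013_Thm553.of_stability`, `Temkin2013_Thm551iii_inertial.of_stability` with the
normality of toric charts, `Temkin2013_Thm551iii.of_inertial`), and Thm. 5.5.2 (i) is assembled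
from them (`Temkin2013Abhyankar.of_section5`).
[cite: Temkin2013, Thm. 5.5.2 (i) (p. 60 of arXiv:0804.1554v3)] [cite: Kuhlmann2010, Thm. 1.1] -/
theorem Temkin2013Abhyankar.of_stability (hS : Kuhlmann2010Stability.{u}) :
    Temkin2013Abhyankar.{u} :=
  Temkin2013Abhyankar.of_section5 (Temkin2013_Thm553.of_stability hS)
    (Temkin2013_Thm551iii.of_inertial (Temkin2013_Thm551iii_inertial.of_stability hS))

/-- **The induction step on the height (Temkin 2013, §4.2) from three published theorems**:
Kuhlmann's generalized stability theorem (`Kuhlmann2010Stability`), Thm. 3.3.1 for smooth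
generic fibres (`Temkin2013RelativeCurveSmoothFibre`) and the decompletion Lemma 3.3.2 in its
corrected rendering (`Temkin2013_Lemma332_nft`) imply `Temkin2013HeightStep`; all other inputs
of the printed argument (Steps 0–2 of §4.2, Steps 0–4 of the proof of Thm. 4.1.1, curve
smoothing, Lemmas 2.8.4/2.8.5, Prop. 5.4.3, Cor. 5.4.2, Thm. A.2.1, Matsumura 26.9, E. Noether's
finiteness) are theorems of the tree. This is the current trust base of the fact.
[cite: Temkin2013, Section 4.2 (arXiv:0804.1554v3 pp. 50–51)] -/
theorem Temkin2013HeightStep.of_stability_smoothFibre_lemma332nft (hS : Kuhlmann2010Stability.{u})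
    (hsf : Temkin2013RelativeCurveSmoothFibre.{u}) (h332 : Temkin2013_Lemma332_nft.{u}) :
    Temkin2013HeightStep.{u} :=
  Temkin2013HeightStep.of_abhyankar_smoothFibre_lemma332nft (Temkin2013Abhyankar.of_stability hS)
    hsf h332

end Literature.AlgebraicGeometry.Resolution
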